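import Literature.MathematicalPhysics.QuantumFieldTheory.Balaban1983to89.B9CubeLettersBondOpsAtOneL0
import Literature.MathematicalPhysics.QuantumFieldTheory.Balaban1983to89.B9Thm33CubeAtOne
import Literature.MathematicalPhysics.QuantumFieldTheory.Balaban1983to89.B6Dg288ChartV1L0

/-!
# `Balaban1983to89.B9CubeLettersBondOpsAtOneIdentL0` — THE PRINTED IDENTIFICATION «Δ_a(U) coincides with Δ_a in (2.19) if U = 1» FOR THE
# CUBE-LOCAL BOND-SECTOR LETTERS: `Δ_{a,□}(1)` IS THE LIFT OF [4]'s TYPED `Δ_a` OF THE CUBE SEQUENCE (`deltaAE (domCube i q) c_f w_□`) AND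
# `G_□(1) = Δ_{a,□}(1)⁻¹` IS THE LIFT OF ITS GENUINE INVERSE `GE (domCube i q)` — so that `B9Thm33CubeAtOne` IS [B9] Thm 3.3 at `U = 1` FOR THE
# LETTER `GACubeY` (sub-row G-B9-LETTERS, module M5.1c PART 2 (P4), file 3 = the last step)

FRAMING (verbatim cell line):
statement-level skeleton of published theorems with citation tags; proofs where landed; nothing here is a claim about the Yang–Mills mass gap

Sources under audit (cell lit-balaban): T. Bałaban, *Propagators for lattice gauge theories in a background field*, Commun. Math. Phys. **99**
(1985) 389–434 [`Balaban1985BackgroundPropagators`, "B9"], (3.25) p. 394, (3.26)–(3.27) p. 395 («It coincides with Δ_a in (2.19) if U = 1»),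
Cor. 3.5 p. 407 («the external gauge field configuration U = 1»), p. 409 l. 3–5; T. Bałaban, *Propagators and renormalization transformations
for lattice gauge theories. II*, Commun. Math. Phys. **96** (1984) 223–250 [`Balaban1984PropagatorsII`, "[4]"], (2.13)–(2.17) p. 225 («let R
be an orthogonal projection in the space L²(T_η) onto the subspace ΔN(Q′)»), (2.19), (2.22) p. 226.  Held text
`paper:balaban1985-cmp99-background-propagators` p0006 ∕ p0007 ∕ p0019 ∕ p0021.  Unit `lit-balaban-r05` (r05 gen 80); lead g29 RULING #5
(P4) = (α); predecessor files `B9CubeLettersBondOpsL0` (p600412), `B9CubeLettersBondOpsAtOneL0` (p600682), `B9Thm33CubeAtOne` (p599934).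

## WHAT IS PRINTED (verbatim up to notation)

[B9] p. 409 l. 3–5: «The operators constructed for this sequence, which we denote by G′_□(U), C_□(U) = (Q′(U)G′_□²(U)Q′*(U))⁻¹, G_□(U),
satisfy all the inequalities of Theorems 3.1–3.3 correspondingly.»  (3.25) p. 394: «Rf = (I − G′Q′*(Q′G′²Q′*)⁻¹Q′G′)f, where
G′ = G′(U) = (Δ′_a)⁻¹»; (3.26) p. 395: «Δ_a(U) = Δ(U) + D_UR(U)D*_U + Q*(U)aQ(U), or simply Δ_a = Δ + DRD* + Q*aQ.  It coincides with Δ_a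
in (2.19) if U = 1.»; (3.27): «G(U) = G = (Δ_a|Ω₀)⁻¹».  [4] p. 225: «let R be an orthogonal projection in the space L²(T_η) onto the subspace
ΔN(Q′) … Rf = Δλ = Δ′_aλ = f − G′Q′*(Q′G′²Q′*)⁻¹Q′G′f (2.17)».

## WHAT THIS FILE CERTIFIES (theorems only; `F := cubeFamY i q` the cube sequence `{Ω_n(□)}` of p. 408 as ONE `…L0.TDomains`,
## `G′_□(1) = gpWc i q`, `(Q′G′_□²Q′*)⁻¹(1) = xinvKc i q`, `R_□(1) = rKc i q := 1 − G′_□Q′*(Q′G′_□²Q′*)⁻¹Q′G′_□`)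

§1 THE MATRIX `R_□(1)` IS THE ORTHOGONAL PROJECTION OF [4] (2.17) FOR THE CUBE SEQUENCE: `rKc_mul_rKc` (`R² = R`), `rKc_transpose`
(`Rᵀ = R`, from `G′_□ᵀ = G′_□`, `(Q′*)ᵀ = diag(W)Q′` and the symmetry of `diag(W)(Q′G′_□²Q′*)⁻¹` — p21's `pM_transpose` at the cube sequence),
`rKc_range_QB` (`∀ f ∃ λ, Q′_□λ = 0 ∧ R_□f = Δ′_{a,□}λ`, the printed `λ` of the line before (2.17)), `rKc_mulVec_mlOpT_of_QB` (`R_□Δ′_{a,□}λ = Δ′_{a,□}λ`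
for `Q′_□λ = 0`), hence — §4 of `B6ScalarChartV1L0`: on `N(Q′)` the averaging part of `Δ′_a` vanishes, so `Δ′_{a,□}N(Q′_□) = (−Δ^{per})N(Q′_□)`
does NOT depend on the weights — ★ `RE_domCube_chart`: the V1 ORTHOGONAL PROJECTION `RE (domCube i q) c` of [4] Sect. A for the cube sequence's
bond-domain structure IS `rKc i q` READ THROUGH THE CHART (`B6ScalarChartV1L0.RE_chart`), for every `c ≠ 0`.

§2 THE FLAT IDENTITY AT THE CUBE SEQUENCE: `onFun_RE_domCube_apply`, `gradK_rKc_divK_mulVec`, ★ `onFun_deltaAE_domCube_eq` — [4]'s typed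
`Δ_a = ∂*∂ + ∂R∂* + Q*aQ` (2.19) of `domCube i q` with the weights `wCubeBond i q`, read on fine-bond functions, IS
`cocurlK·curlK + gradK·rKc·divK + qsKc·aKc·qKc` (`Node00.OpsYDeltaA.onFun_deltaAE_eq` at the cube sequence).

§3 THE LETTERS AT `U = 1` (all transporters `= 1`): ★★ `deltaACubeY_one_liftY` ∕ `deltaACubeY_one_deltaAE` —
`Δ_{a,□}(1) = liftEndY (onFun (deltaAE (domCube i q) c_f (wCubeBond i q)))` («It coincides with Δ_a in (2.19) if U = 1», for the cube sequence);
`onFun_deltaAE_domCube_comp_GE`, `isUnit_onFun_deltaAE_domCube` ([4] (2.22) `Δ_aG = 1` for the cube sequence, r03's `GE`);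
★★ `GACubeY_one_liftY` ∕ `GACubeY_one` — `G_□(1) = liftEndY (onFun (GE (domCube i q) hc_f (wCubeBond_pos i q hb₀)))`: the `Ring.inverse`
letter `GACubeY` of `B9CubeLettersBondOpsL0` AT `U = 1` IS THE LIFT OF THE GENUINE INVERSE whose entries, gradient entries and Laplacian entries
are majorised by `B9Thm33CubeAtOne.thm33_cube_atOne_G` and whose `H_□`-companion by `thm33_cube_atOne_H ∕ _DH` — i.e. THOSE THEOREMS ARE
[B9] Thm 3.3 p. 399 at `U = 1` (Cor. 3.5 p. 407) FOR THE LETTER `GACubeY i q parS parB` at `U = 1`, by name; `isUnit_deltaACubeY_one`,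
`GACubeY_one_comp_deltaACubeY_one`, `deltaACubeY_one_comp_GACubeY_one`.

## HONEST SCOPE

* `U = 1` only (Cor. 3.5's case «proved in [4]»); the small-field case of Thm 3.3 (general `U` in the domain (3.37)) is NOT here.  Lattice units and
  conventions M1–M5 of `Node00.OpsYDeltaA`; the weights off the member's index bonds are the band's lower edge (`B9CubeBondWeights`, a choice print
  leaves open); `b₀ > 0` is needed for the inverse (`wCubeBond_pos`).  No inequality is proved here — the estimates are `B9Thm33CubeAtOne`'s
  (from `B6Prop26LapKLevelV1L0` ∕ `B6Cor28EntriesKLevelV1L0`), this file only identifies their operator with the letter.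
* Nothing is inferred from the manuscript; kernel-checked; 0 new definitions, 0 facts.  NOT summit progress; the YM mass gap is not proved by any
  of this.
-/

namespace Literature.MathematicalPhysics.QuantumFieldTheory.Balaban1983to89.B9CubeLettersBondOpsAtOneIdentL0

open LatticeFieldCalculus
open Node00
open Literature.MathematicalPhysics.QuantumFieldTheory.Balaban1983to89.B6KLevelCensusIndexV1 (KIdx)
open Literature.MathematicalPhysics.QuantumFieldTheory.Balaban1983to89.B6Cover236MultiLevelBlocks (cubes)
open Literature.MathematicalPhysics.QuantumFieldTheory.Balaban1983to89.B6MultiLevelTorusOperator (perLapT mlOpT gmlT_isSymm)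
open Literature.MathematicalPhysics.QuantumFieldTheory.Balaban1983to89.B6Ineq268MultiLevelBoxL0 (W QB W_pos)
open Literature.MathematicalPhysics.QuantumFieldTheory.Balaban1983to89.B6Ineq288MultiLevelTorusL0 (QM QsM QsM_transpose QM_eq_diag_mul QB_eq_QM_mulVec)
open Literature.MathematicalPhysics.QuantumFieldTheory.Balaban1983to89.B6Ineq2133TwoScaleV1 (onFun onFun_apply)
open Literature.MathematicalPhysics.QuantumFieldTheory.Balaban1983to89.B6Cor28KLevelV1 (onFun_comp)
open Literature.MathematicalPhysics.QuantumFieldTheory.Balaban1983to89.B6AgreeLapV1Chart (onFun_add)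
open Literature.MathematicalPhysics.QuantumFieldTheory.Balaban1983to89.B6SectAOperatorsV1 (ScalarSpace dE dsE QE QsE aE RE)
open Literature.MathematicalPhysics.QuantumFieldTheory.Balaban1983to89.B6SectAVectorModelV1 (deltaAE deltaAE_def GE)
open Literature.MathematicalPhysics.QuantumFieldTheory.Balaban1983to89.B6GlobalChartV1 (PV boxEquiv toBox)
open Literature.MathematicalPhysics.QuantumFieldTheory.Balaban1983to89.B6ScalarChartV1L0 (RE_chart range_fix_of_mlOpT)
open Literature.MathematicalPhysics.QuantumFieldTheory.Balaban1983to89.B9CubeLettersOpsL0 (cubeFamY oddMh)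
open Literature.MathematicalPhysics.QuantumFieldTheory.Balaban1983to89.B9CubeBondWeights (domCube wCubeBond wCubeBond_pos)
open Literature.MathematicalPhysics.QuantumFieldTheory.Balaban1983to89.B9Thm31CubeLocalFlat (wCube mlOpT_mul_GpCubeW GpCubeW_mul_mlOpT)
open Literature.MathematicalPhysics.QuantumFieldTheory.Balaban1983to89.B9Cor35AtOneInverseLetters (one_le_ell linearMap_ext_of_liftY
  clause_of_ringInverse eq_liftEndY_of_ringInverse isUnit_liftEndY)
open Literature.MathematicalPhysics.QuantumFieldTheory.Balaban1983to89.B9CubeLettersBondOpsL0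
open Literature.MathematicalPhysics.QuantumFieldTheory.Balaban1983to89.B9CubeLettersBondOpsAtOneL0
open scoped Matrix

noncomputable section

variable {d ℓ : ℕ} {hd : 1 ≤ d + 1} {hL : Odd (ℓ + 1) ∧ 1 < ℓ + 1} {b₀ b₁ : ℝ}

/-! ## §1 `R_□(1)` is the orthogonal projection (2.17) of the cube sequence; V1's `R` of `domCube` through the chart -/

section Projection

variable (i : KIdx d ℓ hd hL b₀ b₁) (q : ↥(cubes (toKT i).D.toDomains))

/-- `Δ′_{a,□}·G′_□(1) = 1` for the cube sequence (`B9Thm31CubeLocalFlat.mlOpT_mul_GpCubeW` at the index).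
[cite: Balaban1985BackgroundPropagators, (3.25) p.394 («G′ = G′(U) = (Δ′_a)⁻¹»); Balaban1984PropagatorsII, p.225 («G′ = Δ′_a^{−1}»)] -/
theorem mlOpT_mul_gpWc : mlOpT (toKT i).NB ℓ (toKT i).k (cubeFamY i q).lev (wCube ℓ) * gpWc i q = 1 :=
  mlOpT_mul_GpCubeW (one_le_ell i) (toKT i).D q hL.1 (oddMh i) (toKT i).hMh (toKT i).hP

/-- `G′_□(1)·Δ′_{a,□} = 1`. [cite: Balaban1985BackgroundPropagators, (3.25) p.394; Balaban1984PropagatorsII, p.225 («G′ = Δ′_a^{−1}»)] -/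
theorem gpWc_mul_mlOpT : gpWc i q * mlOpT (toKT i).NB ℓ (toKT i).k (cubeFamY i q).lev (wCube ℓ) = 1 :=
  GpCubeW_mul_mlOpT (one_le_ell i) (toKT i).D q hL.1 (oddMh i) (toKT i).hMh (toKT i).hP

/-- `G′_□(1)ᵀ = G′_□(1)`. [cite: Balaban1984PropagatorsII, p.225 («a well defined, positive operator»)] -/
theorem gpWc_transpose : (gpWc i q)ᵀ = gpWc i q := gmlT_isSymm

/-- `(Q′G′_□²Q′*)⁻¹·(Q′G′_□²Q′*) = 1` (the other order of `xK_mul_xinvKc`). [cite: Balaban1984PropagatorsII, (2.17) p.225, p.235 («its inverse is well defined»)] -/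
theorem xinvKc_mul_xK : xinvKc i q * (qpKc i q * gpWc i q * gpWc i q * qpsKc i q) = 1 :=
  mul_eq_one_comm.1 (xK_mul_xinvKc i q)

/-- `1 − R_□(1) = P_□(1) = G′_□Q′*(Q′G′_□²Q′*)⁻¹Q′G′_□`. [cite: Balaban1985BackgroundPropagators, (3.25) p.394; Balaban1984PropagatorsII, (2.17) p.225, (2.18) p.226] -/
theorem one_sub_rKc : 1 - rKc i q = gpWc i q * qpsKc i q * xinvKc i q * qpKc i q * gpWc i q := by
  unfold rKc; rw [sub_sub_cancel]

/-- `P_□² = P_□`. [cite: Balaban1984PropagatorsII, (2.17) p.225 («let R be an orthogonal projection»)] -/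
theorem pKc_mul_pKc :
    (gpWc i q * qpsKc i q * xinvKc i q * qpKc i q * gpWc i q) * (gpWc i q * qpsKc i q * xinvKc i q * qpKc i q * gpWc i q) =
      gpWc i q * qpsKc i q * xinvKc i q * qpKc i q * gpWc i q := by
  have hX := xK_mul_xinvKc i q
  have key : ∀ Z : Matrix (BlkCubeY i q) (SiteY i) ℝ, qpKc i q * (gpWc i q * (gpWc i q * (qpsKc i q * (xinvKc i q * Z)))) = Z := by
    intro Z
    calc qpKc i q * (gpWc i q * (gpWc i q * (qpsKc i q * (xinvKc i q * Z))))
        = (qpKc i q * gpWc i q * gpWc i q * qpsKc i q * xinvKc i q) * Z := by simp only [Matrix.mul_assoc]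
      _ = Z := by rw [hX, Matrix.one_mul]
  simp only [Matrix.mul_assoc]
  rw [key]

/-- **`R_□(1)² = R_□(1)`**. [cite: Balaban1984PropagatorsII, (2.17) p.225 («orthogonal projection»); Balaban1985BackgroundPropagators, (3.25) p.394] -/
theorem rKc_mul_rKc : rKc i q * rKc i q = rKc i q := by
  have hP := pKc_mul_pKc i q
  unfold rKc
  rw [sub_mul, one_mul, mul_sub, mul_one, hP, sub_self, sub_zero]

/-- **`P_□(1)ᵀ = P_□(1)`** — p21's `B6Ineq288MultiLevelTorusL0.pM_transpose` at the cube sequence (`diag(W)·(Q′G′_□²Q′*)⁻¹` symmetric,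
`(Q′*)ᵀG′_□²Q′*` symmetric, `G′_□ᵀ = G′_□`). [cite: Balaban1984PropagatorsII, (2.17) p.225 («orthogonal projection»)] -/
theorem pKc_transpose :
    (gpWc i q * qpsKc i q * xinvKc i q * qpKc i q * gpWc i q)ᵀ = gpWc i q * qpsKc i q * xinvKc i q * qpKc i q * gpWc i q := by
  have hG : (gpWc i q)ᵀ = gpWc i q := gpWc_transpose i q
  have hXG : qpKc i q * gpWc i q * gpWc i q * qpsKc i q * xinvKc i q = 1 := xK_mul_xinvKc i q
  have hGX : xinvKc i q * (qpKc i q * gpWc i q * gpWc i q * qpsKc i q) = 1 := xinvKc_mul_xK i q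
  -- `Dg = diag(W)`, `Dgi = diag(W⁻¹)` on the cube sequence's blocks
  obtain ⟨Dg, hDg⟩ : ∃ Dg : Matrix (BlkCubeY i q) (BlkCubeY i q) ℝ,
    Dg = Matrix.diagonal (fun y => W (cubeFamY i q).toDomains y) := ⟨_, rfl⟩
  obtain ⟨Dgi, hDgi⟩ : ∃ Dgi : Matrix (BlkCubeY i q) (BlkCubeY i q) ℝ,
    Dgi = Matrix.diagonal (fun y => (W (cubeFamY i q).toDomains y)⁻¹) := ⟨_, rfl⟩
  have hDD : Dg * Dgi = 1 := by
    rw [hDg, hDgi, Matrix.diagonal_mul_diagonal, ← Matrix.diagonal_one]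
    congr 1; funext y; exact mul_inv_cancel₀ (W_pos _ _).ne'
  have hDiD : Dgi * Dg = 1 := mul_eq_one_comm.1 hDD
  have hDgT : Dgᵀ = Dg := by rw [hDg, Matrix.diagonal_transpose]
  have L2 : (qpsKc i q)ᵀ = Dg * qpKc i q := by rw [hDg]; exact QsM_transpose (cubeFamY i q)
  have L1 : (qpKc i q)ᵀ = qpsKc i q * Dgi := by
    rw [hDgi, show qpKc i q = QM (cubeFamY i q) from rfl, QM_eq_diag_mul, Matrix.transpose_mul, Matrix.transpose_transpose,
      Matrix.diagonal_transpose]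
    rfl
  -- `S = (Q′*)ᵀG′_□²Q′* = Dg·X` is symmetric (`X = Q′G′_□²Q′*`)
  have hS : Dg * (qpKc i q * gpWc i q * gpWc i q * qpsKc i q) = (qpsKc i q)ᵀ * gpWc i q * gpWc i q * qpsKc i q := by
    rw [L2]; simp only [Matrix.mul_assoc]
  have hSsymm : ((qpsKc i q)ᵀ * gpWc i q * gpWc i q * qpsKc i q)ᵀ = (qpsKc i q)ᵀ * gpWc i q * gpWc i q * qpsKc i q := by
    rw [Matrix.transpose_mul, Matrix.transpose_mul, Matrix.transpose_mul, Matrix.transpose_transpose, hG]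
    simp only [Matrix.mul_assoc]
  -- `T = Dg·X⁻¹` is symmetric: `(X⁻¹)ᵀ·Dg·X = Dg = Dg·X⁻¹·X`, cancel `X` by `X·X⁻¹ = 1`
  have hSG : (qpsKc i q)ᵀ * gpWc i q * gpWc i q * qpsKc i q * xinvKc i q = Dg := by
    rw [← hS, Matrix.mul_assoc, hXG, Matrix.mul_one]
  have hTt : (xinvKc i q)ᵀ * Dg * (qpKc i q * gpWc i q * gpWc i q * qpsKc i q) = Dg := by
    rw [Matrix.mul_assoc, hS, ← hSsymm, ← Matrix.transpose_mul, hSG, hDgT]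
  have hT : (xinvKc i q)ᵀ * Dg = Dg * xinvKc i q := by
    have h1 : (xinvKc i q)ᵀ * Dg * (qpKc i q * gpWc i q * gpWc i q * qpsKc i q) =
        Dg * xinvKc i q * (qpKc i q * gpWc i q * gpWc i q * qpsKc i q) := by
      rw [hTt, Matrix.mul_assoc, hGX, Matrix.mul_one]
    calc (xinvKc i q)ᵀ * Dg = (xinvKc i q)ᵀ * Dg * (qpKc i q * gpWc i q * gpWc i q * qpsKc i q) * xinvKc i q := by
          rw [Matrix.mul_assoc ((xinvKc i q)ᵀ * Dg), hXG, Matrix.mul_one]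
      _ = Dg * xinvKc i q * (qpKc i q * gpWc i q * gpWc i q * qpsKc i q) * xinvKc i q := by rw [h1]
      _ = Dg * xinvKc i q := by rw [Matrix.mul_assoc (Dg * xinvKc i q), hXG, Matrix.mul_one]
  have hGi : Dgi * (xinvKc i q)ᵀ * Dg = xinvKc i q := by
    rw [Matrix.mul_assoc, hT, ← Matrix.mul_assoc, hDiD, Matrix.one_mul]
  -- assemble
  calc (gpWc i q * qpsKc i q * xinvKc i q * qpKc i q * gpWc i q)ᵀ
      = gpWc i q * (qpsKc i q * (Dgi * ((xinvKc i q)ᵀ * (Dg * (qpKc i q * gpWc i q))))) := by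
        simp only [Matrix.transpose_mul, hG, L1, L2, Matrix.mul_assoc]
    _ = gpWc i q * (qpsKc i q * ((Dgi * (xinvKc i q)ᵀ * Dg) * (qpKc i q * gpWc i q))) := by simp only [Matrix.mul_assoc]
    _ = gpWc i q * qpsKc i q * xinvKc i q * qpKc i q * gpWc i q := by rw [hGi]; simp only [Matrix.mul_assoc]

/-- **`R_□(1)ᵀ = R_□(1)`**. [cite: Balaban1984PropagatorsII, (2.17) p.225 («orthogonal projection»); Balaban1985BackgroundPropagators, (3.25) p.394] -/
theorem rKc_transpose : (rKc i q)ᵀ = rKc i q := by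
  have hP := pKc_transpose i q
  unfold rKc
  rw [Matrix.transpose_sub, Matrix.transpose_one, hP]

/-- `Q′_□λ = 0` for the printed `λ = G′_□f − G′_□²Q′*(Q′G′_□²Q′*)⁻¹Q′G′_□f` of the line before (2.17). [cite: Balaban1984PropagatorsII, p.225 (line before (2.17))] -/
theorem qpKc_mulVec_lam (f : SiteY i → ℝ) :
    qpKc i q *ᵥ (gpWc i q *ᵥ f - gpWc i q *ᵥ (gpWc i q *ᵥ (qpsKc i q *ᵥ (xinvKc i q *ᵥ (qpKc i q *ᵥ (gpWc i q *ᵥ f)))))) = 0 := by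
  rw [Matrix.mulVec_sub]
  simp only [Matrix.mulVec_mulVec, ← Matrix.mul_assoc]
  rw [xK_mul_xinvKc i q, Matrix.one_mul, sub_self]

/-- **(2.17) FOR THE CUBE SEQUENCE**: `R_□f = Δ′_{a,□}λ` with the printed `λ`. [cite: Balaban1984PropagatorsII, (2.17) p.225 («Rf = Δλ = Δ′_aλ = f − G′Q′*(Q′G′²Q′*)⁻¹Q′G′f»); Balaban1985BackgroundPropagators, (3.25) p.394] -/
theorem rKc_mulVec_eq (f : SiteY i → ℝ) :
    rKc i q *ᵥ f = mlOpT (toKT i).NB ℓ (toKT i).k (cubeFamY i q).lev (wCube ℓ) *ᵥ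
      (gpWc i q *ᵥ f - gpWc i q *ᵥ (gpWc i q *ᵥ (qpsKc i q *ᵥ (xinvKc i q *ᵥ (qpKc i q *ᵥ (gpWc i q *ᵥ f)))))) := by
  have hΔ := mlOpT_mul_gpWc i q
  unfold rKc
  rw [Matrix.sub_mulVec, Matrix.one_mulVec, Matrix.mulVec_sub]
  simp only [Matrix.mulVec_mulVec, ← Matrix.mul_assoc]
  rw [hΔ, Matrix.one_mulVec, Matrix.one_mul]

/-- `R_□(1)` maps into `Δ′_{a,□}N(Q′_□)`: `∀ f ∃ λ, Q′_□λ = 0 ∧ R_□f = Δ′_{a,□}λ`. [cite: Balaban1984PropagatorsII, (2.17) p.225] -/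
theorem rKc_range_QB (f : SiteY i → ℝ) :
    ∃ lam : SiteY i → ℝ, QB (cubeFamY i q).toDomains lam = 0 ∧
      rKc i q *ᵥ f = mlOpT (toKT i).NB ℓ (toKT i).k (cubeFamY i q).lev (wCube ℓ) *ᵥ lam :=
  ⟨_, by rw [QB_eq_QM_mulVec]; exact qpKc_mulVec_lam i q f, rKc_mulVec_eq i q f⟩

/-- … and `R_□(1)` FIXES `Δ′_{a,□}N(Q′_□)`: `R_□(Δ′_{a,□}λ) = Δ′_{a,□}λ` whenever `Q′_□λ = 0`. [cite: Balaban1984PropagatorsII, p.225 («onto the subspace ΔN(Q′)»)] -/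
theorem rKc_mulVec_mlOpT_of_QB {lam : SiteY i → ℝ} (h : QB (cubeFamY i q).toDomains lam = 0) :
    rKc i q *ᵥ (mlOpT (toKT i).NB ℓ (toKT i).k (cubeFamY i q).lev (wCube ℓ) *ᵥ lam) =
      mlOpT (toKT i).NB ℓ (toKT i).k (cubeFamY i q).lev (wCube ℓ) *ᵥ lam := by
  have h' : qpKc i q *ᵥ lam = 0 := by rw [QB_eq_QM_mulVec] at h; exact h
  have hG := gpWc_mul_mlOpT i q
  unfold rKc
  rw [Matrix.sub_mulVec, Matrix.one_mulVec, sub_eq_self]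
  simp only [Matrix.mulVec_mulVec]
  rw [Matrix.mul_assoc _ (gpWc i q) (mlOpT _ _ _ _ _), hG, Matrix.mul_one, ← Matrix.mulVec_mulVec, h', Matrix.mulVec_zero]

/-- the two projection hypotheses of `B6ScalarChartV1L0.RE_chart` for `R_□(1)`, in the `perLapT` form (on `N(Q′_□)` the averaging part of
`Δ′_{a,□}` vanishes — `range_fix_of_mlOpT`; in particular the subspace `Δ′_{a,□}N(Q′_□) = (−Δ^{per})N(Q′_□)` does not depend on the weights).
[cite: Balaban1984PropagatorsII, (2.13)–(2.17) p.225] -/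
theorem rKc_range_fix :
    (∀ f : SiteY i → ℝ, ∃ lam : SiteY i → ℝ, QB (cubeFamY i q).toDomains lam = 0 ∧ rKc i q *ᵥ f = perLapT (toKT i).NB *ᵥ lam) ∧
      (∀ lam : SiteY i → ℝ, QB (cubeFamY i q).toDomains lam = 0 →
        rKc i q *ᵥ (perLapT (toKT i).NB *ᵥ lam) = perLapT (toKT i).NB *ᵥ lam) :=
  range_fix_of_mlOpT (cubeFamY i q) (wCube ℓ) (rKc i q) (rKc_range_QB i q) (fun _ h => rKc_mulVec_mlOpT_of_QB i q h)

/-- ★ **V1's ORTHOGONAL PROJECTION `R` OF THE CUBE SEQUENCE'S BOND-DOMAIN STRUCTURE IS `R_□(1)` THROUGH THE CHART**: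
`RE (domCube i q) c f x = (rKc·(f ∘ chart⁻¹))(toBox x)` for every `c ≠ 0` (uniqueness of the orthogonal projection onto `(−Δ^{per})N(Q′_□)`,
`B6ScalarChartV1L0.RE_chart` fed with `rKc_transpose` ∕ `rKc_range_fix`). [cite: Balaban1984PropagatorsII, (2.17) p.225; Balaban1985BackgroundPropagators, (3.25) p.394, p.409 l.3–5] -/
theorem RE_domCube_chart {c : ℝ} (hc : c ≠ 0) (f : ScalarSpace (PV d ℓ i.m i.K hd hL)) (x : Site (PV d ℓ i.m i.K hd hL) 0) :
    RE (domCube i q) c f x = (rKc i q *ᵥ fun z => f ((boxEquiv i.hN).symm z)) (toBox i.hN x) :=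
  RE_chart i.hN (cubeFamY i q) i.hk hc (rKc i q) (rKc_transpose i q) (rKc_range_fix i q).1 (rKc_range_fix i q).2 f x

end Projection

/-! ## §2 The flat identity (2.19) at the cube sequence -/

section Flat

variable (i : KIdx d ℓ hd hL b₀ b₁) (q : ↥(cubes (toKT i).D.toDomains))

/-- the cube sequence's V1 projection read on functions IS `rKc` through the chart (operator form of `RE_domCube_chart` at `c = c_f`).
[cite: Balaban1984PropagatorsII, (2.17) p.225] -/
theorem onFun_RE_domCube_apply (g : Site (PV d ℓ i.m i.K hd hL) 0 → ℝ) (x : Site (PV d ℓ i.m i.K hd hL) 0) :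
    onFun (RE (domCube i q) i.cf) g x = (rKc i q *ᵥ fun z => g ((boxEquiv i.hN).symm z)) (toBox i.hN x) := by
  rw [onFun_apply, RE_domCube_chart i q i.hcf]

/-- **the `∂R_□∂*` term at `U = 1`**: `gradK·(rKc·(divK·A)) = (∂ ∘ R ∘ ∂*)A` with V1's `R = RE (domCube i q) c_f`.
[cite: Balaban1985BackgroundPropagators, (3.26) p.395; Balaban1984PropagatorsII, (2.19) p.226] -/
theorem gradK_rKc_divK_mulVec (A : FBondY i → ℝ) :
    gradK i *ᵥ (rKc i q *ᵥ (divK i *ᵥ A)) =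
      onFun (dE (P := PV d ℓ i.m i.K hd hL) i.cf)
        (onFun (RE (domCube i q) i.cf) (onFun (dsE (P := PV d ℓ i.m i.K hd hL) i.cf) A)) := by
  rw [gradK_mulVec, divK_mulVec]
  congr 1
  funext x
  rw [onFun_RE_domCube_apply]
  rfl

/-- ★ **THE FLAT IDENTITY AT THE CUBE SEQUENCE**: [4]'s `Δ_a = ∂*∂ + ∂R∂* + Q*aQ` of (2.19) for `domCube i q` with the weights `w_□`, read on
fine-bond functions, IS the sum of the three flat kernel terms of `B9CubeLettersBondOpsAtOneL0.deltaACubeY_one`.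
[cite: Balaban1984PropagatorsII, (2.19) p.226; Balaban1985BackgroundPropagators, (3.26) p.395 («It coincides with Δ_a in (2.19) if U = 1»), p.409 l.3–5] -/
theorem onFun_deltaAE_domCube_eq (A : FBondY i → ℝ) :
    onFun (deltaAE (domCube i q) i.cf (wCubeBond i q)) A =
      cocurlK i *ᵥ (curlK i *ᵥ A) + gradK i *ᵥ (rKc i q *ᵥ (divK i *ᵥ A)) + qsKc i q *ᵥ (aKc i q *ᵥ (qKc i q *ᵥ A)) := by
  rw [deltaAE_def, onFun_add, onFun_add, onFun_comp, onFun_comp, onFun_comp, onFun_comp, onFun_comp, gradK_rKc_divK_mulVec]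
  simp only [LinearMap.add_apply, LinearMap.comp_apply, cocurlK, curlK, qsKc, aKc, qKc, LinearMap.toMatrix'_mulVec]

end Flat

/-! ## §3 `Δ_{a,□}(1)` and `G_□(1)` are the lifts of [4]'s typed `Δ_a` of the cube sequence and of its genuine inverse -/

section AtOne

variable {𝔸 : Type} [NormedRing 𝔸] [NormedAlgebra ℂ 𝔸] [CompleteSpace 𝔸]
variable (i : KIdx d ℓ hd hL b₀ b₁) (q : ↥(cubes (toKT i).D.toDomains))

/-- ★★ **«IT COINCIDES WITH Δ_a IN (2.19) IF U = 1» FOR THE CUBE SEQUENCE, ON PRODUCT FORMS**: `Δ_{a,□}(1)(A ⊗ E) = (Δ_a A) ⊗ E` with [4]'s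
typed `Δ_a = onFun (deltaAE (domCube i q) c_f w_□)`. [cite: Balaban1985BackgroundPropagators, (3.26) p.395 («It coincides with Δ_a in (2.19) if U = 1»), p.409 l.3–5; Balaban1984PropagatorsII, (2.19) p.226] -/
theorem deltaACubeY_one_liftY {parS : SiteParY 𝔸 i} {parB : BondParY 𝔸 i} (hparS : ∀ z w, parS (fun _ _ => 1) z w = 1)
    (hparB : ∀ s s', parB (fun _ _ => 1) s s' = 1) (A : FBondY i → ℝ) (E : 𝔸) :
    deltaACubeY i q parS parB (fun _ _ => 1) (liftY A E) = liftY (onFun (deltaAE (domCube i q) i.cf (wCubeBond i q)) A) E := by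
  rw [deltaACubeY_one i q hparS hparB, liftMatY_liftY, onFun_deltaAE_domCube_eq]
  simp only [Matrix.add_mulVec, ← Matrix.mulVec_mulVec]

/-- ★★ **`Δ_{a,□}(1)` IS THE LIFT OF [4]'s TYPED `Δ_a` OF THE CUBE SEQUENCE** as an operator.
[cite: Balaban1985BackgroundPropagators, (3.26) p.395 («It coincides with Δ_a in (2.19) if U = 1»), p.409 l.3–5] -/
theorem deltaACubeY_one_deltaAE {parS : SiteParY 𝔸 i} {parB : BondParY 𝔸 i} (hparS : ∀ z w, parS (fun _ _ => 1) z w = 1)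
    (hparB : ∀ s s', parB (fun _ _ => 1) s s' = 1) :
    deltaACubeY i q parS parB (fun _ _ => 1) = liftEndY 𝔸 (onFun (deltaAE (domCube i q) i.cf (wCubeBond i q))) :=
  linearMap_ext_of_liftY fun A E => by rw [deltaACubeY_one_liftY i q hparS hparB, liftEndY_liftY]

/-- [4] (2.22) `Δ_aG = 1` for the cube sequence, on fine-bond functions: `onFun Δ_a ∘ onFun G = id` with r03's genuine inverse `GE (domCube i q)`
(weights positive for `b₀ > 0`). [cite: Balaban1984PropagatorsII, (2.22) p.226 («G = Δ_a⁻¹»); Balaban1985BackgroundPropagators, (3.27) p.395] -/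
theorem onFun_deltaAE_domCube_comp_GE (hb₀ : 0 < b₀) :
    onFun (deltaAE (domCube i q) i.cf (wCubeBond i q)) ∘ₗ onFun (GE (domCube i q) i.hcf (wCubeBond_pos i q hb₀)) = LinearMap.id := by
  have h := B6OpTransposeV1.onFun_deltaAE_mul_GE (domCube i q) i.hcf (wCubeBond_pos i q hb₀)
  rwa [Module.End.mul_eq_comp, Module.End.one_eq_id] at h

/-- [4]'s typed `Δ_a` of the cube sequence, read on fine-bond functions, is a unit (two-sided inverse `onFun (GE (domCube i q) …)`).
[cite: Balaban1984PropagatorsII, (2.22) p.226 («G = Δ_a⁻¹»)] -/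
theorem isUnit_onFun_deltaAE_domCube (hb₀ : 0 < b₀) : IsUnit (onFun (deltaAE (domCube i q) i.cf (wCubeBond i q))) :=
  isUnit_iff_exists.2 ⟨onFun (GE (domCube i q) i.hcf (wCubeBond_pos i q hb₀)),
    B6OpTransposeV1.onFun_deltaAE_mul_GE (domCube i q) i.hcf (wCubeBond_pos i q hb₀),
    B6Prop26KLevelSkeletonV1.onFun_GE_mul_deltaAE (domCube i q) i.hcf (wCubeBond_pos i q hb₀)⟩

/-- ★★ **`G_□(1)(J ⊗ E) = (G J) ⊗ E` WITH r03's GENUINE INVERSE `G = onFun (GE (domCube i q) hc_f (wCubeBond_pos i q hb₀))`** — the `Ring.inverse`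
letter `GACubeY` at `U = 1` on product forms (clause transfer `B9Cor35AtOneInverseLetters.clause_of_ringInverse`).
[cite: Balaban1985BackgroundPropagators, (3.27) p.395 («G(U) = G = (Δ_a|Ω₀)⁻¹»), Cor. 3.5 p.407, p.409 l.3–5; Balaban1984PropagatorsII, (2.22) p.226] -/
theorem GACubeY_one_liftY (hb₀ : 0 < b₀) {parS : SiteParY 𝔸 i} {parB : BondParY 𝔸 i} (hparS : ∀ z w, parS (fun _ _ => 1) z w = 1)
    (hparB : ∀ s s', parB (fun _ _ => 1) s s' = 1) (J : FBondY i → ℝ) (E : 𝔸) :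
    GACubeY i q parS parB (fun _ _ => 1) (liftY J E) = liftY (onFun (GE (domCube i q) i.hcf (wCubeBond_pos i q hb₀)) J) E :=
  clause_of_ringInverse rfl (isUnit_onFun_deltaAE_domCube i q hb₀) (onFun_deltaAE_domCube_comp_GE i q hb₀)
    (deltaACubeY_one_liftY i q hparS hparB) J E

/-- ★★ **`G_□(1)` IS THE LIFT OF THE GENUINE INVERSE `GE (domCube i q)`** — the operator whose entries, gradient entries and Laplacian entries are
majorised by `B9Thm33CubeAtOne.thm33_cube_atOne_G` (and whose `H_□` by `thm33_cube_atOne_H ∕ _DH`): those theorems ARE [B9] Thm 3.3 at `U = 1`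
for the letter `GACubeY i q parS parB`. [cite: Balaban1985BackgroundPropagators, (3.27) p.395, Thm 3.3 p.399, Cor. 3.5 p.407, p.409 l.3–5] -/
theorem GACubeY_one (hb₀ : 0 < b₀) {parS : SiteParY 𝔸 i} {parB : BondParY 𝔸 i} (hparS : ∀ z w, parS (fun _ _ => 1) z w = 1)
    (hparB : ∀ s s', parB (fun _ _ => 1) s s' = 1) :
    GACubeY i q parS parB (fun _ _ => 1) = liftEndY 𝔸 (onFun (GE (domCube i q) i.hcf (wCubeBond_pos i q hb₀))) :=
  eq_liftEndY_of_ringInverse rfl (isUnit_onFun_deltaAE_domCube i q hb₀) (onFun_deltaAE_domCube_comp_GE i q hb₀)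
    (deltaACubeY_one_liftY i q hparS hparB)

/-- `Δ_{a,□}(1)` is invertible (it lifts a unit). [cite: Balaban1985BackgroundPropagators, Thm 3.3 p.399 (U = 1 case = [4]), Cor. 3.5 p.407, bookkeeping] -/
theorem isUnit_deltaACubeY_one (hb₀ : 0 < b₀) {parS : SiteParY 𝔸 i} {parB : BondParY 𝔸 i} (hparS : ∀ z w, parS (fun _ _ => 1) z w = 1)
    (hparB : ∀ s s', parB (fun _ _ => 1) s s' = 1) : IsUnit (deltaACubeY i q parS parB (fun _ _ => 1)) := by
  rw [deltaACubeY_one_deltaAE i q hparS hparB]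
  exact isUnit_liftEndY 𝔸 (isUnit_onFun_deltaAE_domCube i q hb₀)

/-- `G_□(1)·Δ_{a,□}(1) = 1`. [cite: Balaban1985BackgroundPropagators, (3.27) p.395 («G(U) = Δ_a(U)⁻¹»)] -/
theorem GACubeY_one_mul_deltaACubeY_one (hb₀ : 0 < b₀) {parS : SiteParY 𝔸 i} {parB : BondParY 𝔸 i}
    (hparS : ∀ z w, parS (fun _ _ => 1) z w = 1) (hparB : ∀ s s', parB (fun _ _ => 1) s s' = 1) :
    GACubeY i q parS parB (fun _ _ => 1) * deltaACubeY i q parS parB (fun _ _ => 1) = 1 :=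
  GACubeY_mul_deltaACubeY i q (isUnit_deltaACubeY_one i q hb₀ hparS hparB)

/-- `Δ_{a,□}(1)·G_□(1) = 1`. [cite: Balaban1985BackgroundPropagators, (3.27) p.395 («G(U) = Δ_a(U)⁻¹»)] -/
theorem deltaACubeY_one_mul_GACubeY_one (hb₀ : 0 < b₀) {parS : SiteParY 𝔸 i} {parB : BondParY 𝔸 i}
    (hparS : ∀ z w, parS (fun _ _ => 1) z w = 1) (hparB : ∀ s s', parB (fun _ _ => 1) s s' = 1) :
    deltaACubeY i q parS parB (fun _ _ => 1) * GACubeY i q parS parB (fun _ _ => 1) = 1 :=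
  deltaACubeY_mul_GACubeY i q (isUnit_deltaACubeY_one i q hb₀ hparS hparB)

end AtOne

end

end Literature.MathematicalPhysics.QuantumFieldTheory.Balaban1983to89.B9CubeLettersBondOpsAtOneIdentL0
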